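import Literature.RingTheory.MvPolynomial.AbsoluteIrreducibilityReduction
import Literature.NumberTheory.DiophantineGeometry.CafureMateraProofs
import HarnessLib

/-!
# Counting rational points on the plane sections of a hypersurface (Cafure–Matera 2006, §4–§5.1)

Library file (theorems only). Let `K = 𝔽_q`, `f ∈ K[x₀, …, xₙ]`, and for parameters
`ν ∈ K^{n+1}`, `ω, η ∈ Kⁿ` let `f_{ν,ω,η}(X, Y) = f(X + ν₀, ωᵢX + ηᵢY + ν_{i+1})` be the plane section
of `f` along the parametrised plane `x₀ = X + ν₀`, `x_{i+1} = ωᵢ X + ηᵢ Y + ν_{i+1}` (Cafure–Matera's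
parametrisations (10); the tree's `Literature.RingTheory.MvPolynomial.planeSection`). We prove:

* `eval_planeSection`, `map_planeSection`, `totalDegree_planeSection_le`: evaluation of the
  section at `(s, t)` is evaluation of `f` at the point `(s + ν₀, ωᵢ s + ηᵢ t + ν_{i+1})` of the plane;
  base change; `deg f_{ν,ω,η} ≤ deg f`;
* `sum_rationalPointCount_planeSection`: **the averaging identity**
  `∑_ν N(f_{ν,ω,η}) = q² · N(f)` for every fixed `(ω, η)` — as `ν` runs over `K^{n+1}` the point
  `(s + ν₀, ωᵢ s + ηᵢ t + ν_{i+1})` runs over `K^{n+1}` for each `(s, t)`. Summed over `(ω, η)` this is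
  the incidence count behind Cafure–Matera's inequality (21) (there phrased with the number `E` of
  planes through a point); in this parametrised form no enumeration of planes is needed.

## References

* A. Cafure, G. Matera, *Improved explicit estimates on the number of solutions of equations over a
  finite field*, Finite Fields Appl. 12 (2006) 155–185, §4 eq. (10), §5.1 eq. (21). [CafureMatera2006]
-/

noncomputable section

open MvPolynomial Literature.RingTheory.MvPolynomial

namespace Literature.NumberTheory.DiophantineGeometry

variable {K : Type*} [Field K] {n : ℕ}

/-! ### Total degree under an affine-linear substitution -/

/-- Substituting polynomials of total degree `≤ 1` does not increase the total degree. [folklore] -/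
theorem totalDegree_aeval_le_of_le_one {R S : Type*} [CommSemiring R] [CommSemiring S] [Algebra R S]
    {σ τ : Type*} (h : σ → MvPolynomial τ S) (hh : ∀ i, (h i).totalDegree ≤ 1) (g : MvPolynomial σ R) :
    (aeval h g).totalDegree ≤ g.totalDegree := by
  classical
  conv_lhs => rw [g.as_sum]
  rw [map_sum]
  refine totalDegree_finsetSum_le fun d hd ↦ ?_
  rw [aeval_monomial, MvPolynomial.algebraMap_apply]
  refine (totalDegree_mul _ _).trans ?_
  rw [totalDegree_C, zero_add, Finsupp.prod]
  refine (totalDegree_finsetProd _ _).trans ?_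
  calc ∑ i ∈ d.support, (h i ^ d i).totalDegree ≤ ∑ i ∈ d.support, d i := by
        gcongr with i
        calc (h i ^ d i).totalDegree ≤ d i * (h i).totalDegree := totalDegree_pow _ _
          _ ≤ d i * 1 := Nat.mul_le_mul_left _ (hh i)
          _ = d i := mul_one _
    _ ≤ g.totalDegree := le_totalDegree hd

/-! ### The plane section: evaluation, base change, degree -/

section Section

variable {L : Type*} [CommRing L] [Algebra K L]

/-- **Evaluating the plane section at `(s, t)` evaluates `f` at the point
`(s + ν₀, ωᵢ s + ηᵢ t + ν_{i+1})` of the parametrised plane.** [cite: CafureMatera2006, §4 eq. (10)] -/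
theorem eval_planeSection (f : MvPolynomial (Fin (n + 1)) K) (ν : Fin (n + 1) → L) (ω η : Fin n → L)
    (x : Fin 2 → L) :
    MvPolynomial.eval x (planeSection f ν ω η) =
      MvPolynomial.aeval
        (Fin.cases (x 0 + ν 0) (fun i : Fin n ↦ ω i * x 0 + η i * x 1 + ν i.succ) : Fin (n + 1) → L) f := by
  unfold planeSection
  have h := comp_aeval_apply
    (f := (Fin.cases (X 0 + C (ν 0)) (fun i : Fin n ↦ C (ω i) * X 0 + C (η i) * X 1 + C (ν i.succ)) :
      Fin (n + 1) → MvPolynomial (Fin 2) L))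
    ((MvPolynomial.aeval x : MvPolynomial (Fin 2) L →ₐ[L] L).restrictScalars K) f
  have hg : (fun i : Fin (n + 1) ↦ ((MvPolynomial.aeval x : MvPolynomial (Fin 2) L →ₐ[L] L).restrictScalars K)
      ((Fin.cases (X 0 + C (ν 0)) (fun i : Fin n ↦ C (ω i) * X 0 + C (η i) * X 1 + C (ν i.succ)) :
        Fin (n + 1) → MvPolynomial (Fin 2) L) i)) =
      (Fin.cases (x 0 + ν 0) (fun i : Fin n ↦ ω i * x 0 + η i * x 1 + ν i.succ) : Fin (n + 1) → L) := by
    funext i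
    refine Fin.cases ?_ (fun j ↦ ?_) i
    · simp only [Fin.cases_zero, AlgHom.restrictScalars_apply, map_add, aeval_X, algHom_C,
        Algebra.algebraMap_self_apply]
    · simp only [Fin.cases_succ, AlgHom.restrictScalars_apply, map_add, map_mul, aeval_X, algHom_C,
        Algebra.algebraMap_self_apply]
  rw [hg] at h
  exact h

/-- Over `K` itself: `f_{ν,ω,η}(s, t) = f(s + ν₀, ωᵢ s + ηᵢ t + ν_{i+1})`. [cite: CafureMatera2006, §4 eq. (10)] -/
theorem eval_planeSection_self (f : MvPolynomial (Fin (n + 1)) K) (ν : Fin (n + 1) → K)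
    (ω η : Fin n → K) (x : Fin 2 → K) :
    MvPolynomial.eval x (planeSection f ν ω η) =
      MvPolynomial.eval
        (Fin.cases (x 0 + ν 0) (fun i : Fin n ↦ ω i * x 0 + η i * x 1 + ν i.succ) : Fin (n + 1) → K) f := by
  rw [eval_planeSection]
  rfl

/-- **Base change of the plane section**: for `K`-rational parameters, the section over an extension
`L` is the image of the section over `K`. [folklore] -/
theorem map_planeSection (f : MvPolynomial (Fin (n + 1)) K) (ν : Fin (n + 1) → K) (ω η : Fin n → K) :
    MvPolynomial.map (algebraMap K L) (planeSection f ν ω η) =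
      planeSection f (algebraMap K L ∘ ν) (algebraMap K L ∘ ω) (algebraMap K L ∘ η) := by
  have h : (MvPolynomial.map (algebraMap K L)).comp
      (MvPolynomial.aeval (R := K) (Fin.cases (X 0 + C (ν 0))
        (fun i : Fin n ↦ C (ω i) * X 0 + C (η i) * X 1 + C (ν i.succ)) :
          Fin (n + 1) → MvPolynomial (Fin 2) K)).toRingHom =
      (MvPolynomial.aeval (R := K) (Fin.cases (X 0 + C (algebraMap K L (ν 0)))
        (fun i : Fin n ↦ C (algebraMap K L (ω i)) * X 0 + C (algebraMap K L (η i)) * X 1 +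
          C (algebraMap K L (ν i.succ))) : Fin (n + 1) → MvPolynomial (Fin 2) L)).toRingHom := by
    refine MvPolynomial.ringHom_ext (fun c ↦ ?_) (fun i ↦ ?_)
    · rw [RingHom.comp_apply, AlgHom.toRingHom_eq_coe, AlgHom.coe_toRingHom, algHom_C,
        MvPolynomial.algebraMap_eq, map_C, AlgHom.toRingHom_eq_coe, AlgHom.coe_toRingHom, aeval_C,
        IsScalarTower.algebraMap_apply K L (MvPolynomial (Fin 2) L), MvPolynomial.algebraMap_eq]
    · rw [RingHom.comp_apply, AlgHom.toRingHom_eq_coe, AlgHom.coe_toRingHom, aeval_X,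
        AlgHom.toRingHom_eq_coe, AlgHom.coe_toRingHom, aeval_X]
      refine Fin.cases ?_ (fun j ↦ ?_) i
      · simp only [Fin.cases_zero, map_add, map_X, map_C]
      · simp only [Fin.cases_succ, map_add, map_mul, map_X, map_C]
  unfold planeSection
  exact RingHom.congr_fun h f

/-- **The plane section has total degree at most `deg f`.** [cite: CafureMatera2006, §4] -/
theorem totalDegree_planeSection_le [Nontrivial L] (f : MvPolynomial (Fin (n + 1)) K)
    (ν : Fin (n + 1) → L) (ω η : Fin n → L) :
    (planeSection f ν ω η).totalDegree ≤ f.totalDegree := by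
  unfold planeSection
  refine totalDegree_aeval_le_of_le_one _ (fun i ↦ ?_) f
  refine Fin.cases ?_ (fun j ↦ ?_) i
  · simp only [Fin.cases_zero]
    refine (totalDegree_add _ _).trans (max_le ?_ ?_)
    · exact (totalDegree_X (R := L) _).le
    · rw [totalDegree_C]; exact Nat.zero_le _
  · simp only [Fin.cases_succ]
    refine (totalDegree_add _ _).trans (max_le ((totalDegree_add _ _).trans (max_le ?_ ?_)) ?_)
    · exact (totalDegree_mul _ _).trans (by rw [totalDegree_C, zero_add]; exact (totalDegree_X (R := L) _).le)
    · exact (totalDegree_mul _ _).trans (by rw [totalDegree_C, zero_add]; exact (totalDegree_X (R := L) _).le)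
    · rw [totalDegree_C]; exact Nat.zero_le _

end Section

/-! ### The averaging identity -/

section Finite

variable [Fintype K] [DecidableEq K]

/-- The point count of a polynomial as a sum of indicators. [folklore] -/
theorem rationalPointCount_eq_sum {m : ℕ} (g : MvPolynomial (Fin m) K) :
    rationalPointCount g = ∑ x : Fin m → K, if MvPolynomial.eval x g = 0 then 1 else 0 := by
  unfold rationalPointCount
  rw [Finset.card_filter]

omit [Fintype K] [DecidableEq K] in
/-- The point of the parametrised plane is a translate of `ν`. [folklore] -/
theorem planePoint_eq_add (ν : Fin (n + 1) → K) (ω η : Fin n → K) (x : Fin 2 → K) :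
    (Fin.cases (x 0 + ν 0) (fun i : Fin n ↦ ω i * x 0 + η i * x 1 + ν i.succ) : Fin (n + 1) → K) =
      ν + Fin.cases (x 0) (fun i : Fin n ↦ ω i * x 0 + η i * x 1) := by
  funext i
  refine Fin.cases ?_ (fun j ↦ ?_) i
  · simp [add_comm]
  · simp [add_comm]

/-- **The averaging identity (Cafure–Matera 2006, the incidence count behind (21)).** For fixed
`(ω, η)`, `∑_{ν ∈ K^{n+1}} N(f_{ν,ω,η}) = q² · N(f)`: for each `(s, t) ∈ K²` the point
`(s + ν₀, ωᵢ s + ηᵢ t + ν_{i+1})` runs over `K^{n+1}` as `ν` does.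
[cite: CafureMatera2006, §5.1 eq. (21)] -/
theorem sum_rationalPointCount_planeSection (f : MvPolynomial (Fin (n + 1)) K) (ω η : Fin n → K) :
    ∑ ν : Fin (n + 1) → K, rationalPointCount (planeSection f ν ω η) =
      Fintype.card K ^ 2 * rationalPointCount f := by
  -- the translation vector attached to `(s, t)`
  let v : (Fin 2 → K) → (Fin (n + 1) → K) := fun x ↦
    Fin.cases (x 0) (fun i : Fin n ↦ ω i * x 0 + η i * x 1)
  have hpt : ∀ (ν : Fin (n + 1) → K) (x : Fin 2 → K),
      MvPolynomial.eval x (planeSection f ν ω η) = MvPolynomial.eval (ν + v x) f := by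
    intro ν x
    rw [eval_planeSection_self, planePoint_eq_add]
  calc ∑ ν : Fin (n + 1) → K, rationalPointCount (planeSection f ν ω η)
      = ∑ ν : Fin (n + 1) → K, ∑ x : Fin 2 → K,
          (if MvPolynomial.eval (ν + v x) f = 0 then 1 else 0) := by
        refine Finset.sum_congr rfl fun ν _ ↦ ?_
        rw [rationalPointCount_eq_sum]
        refine Finset.sum_congr rfl fun x _ ↦ ?_
        rw [hpt]
    _ = ∑ x : Fin 2 → K, ∑ ν : Fin (n + 1) → K,
          (if MvPolynomial.eval (ν + v x) f = 0 then 1 else 0) := Finset.sum_comm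
    _ = ∑ _x : Fin 2 → K, rationalPointCount f := by
        refine Finset.sum_congr rfl fun x _ ↦ ?_
        rw [rationalPointCount_eq_sum]
        exact Fintype.sum_equiv (Equiv.addRight (v x)) _ _ (fun ν ↦ rfl)
    _ = Fintype.card K ^ 2 * rationalPointCount f := by
        rw [Finset.sum_const, Finset.card_univ, smul_eq_mul, Fintype.card_fun, Fintype.card_fin]

/-- The averaging identity summed over all `(ω, η)` with `η ≠ 0` (Cafure–Matera's family `M⁽²⁾` of
parametrisations (10)): `∑_{ν,ω,η≠0} N(f_{ν,ω,η}) = q² qⁿ (qⁿ - 1) N(f)`.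
[cite: CafureMatera2006, §5.1 eq. (16) and (21)] -/
theorem sum_sum_rationalPointCount_planeSection (f : MvPolynomial (Fin (n + 1)) K) :
    ∑ ω : Fin n → K, ∑ η ∈ (Finset.univ : Finset (Fin n → K)).erase 0,
        ∑ ν : Fin (n + 1) → K, rationalPointCount (planeSection f ν ω η) =
      Fintype.card K ^ n * (Fintype.card K ^ n - 1) * (Fintype.card K ^ 2 * rationalPointCount f) := by
  simp_rw [sum_rationalPointCount_planeSection]
  rw [Finset.sum_const, Finset.sum_const, Finset.card_univ, smul_eq_mul, smul_eq_mul,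
    Finset.card_erase_of_mem (Finset.mem_univ _), Finset.card_univ, Fintype.card_fun, Fintype.card_fin]
  ring

/-- **The trivial bound for one section** (Lemma 2.1 in the plane): if the section is not the zero
polynomial it has at most `deg f · q` zeros in `K²`. [cite: CafureMatera2006, Lemma 2.1] -/
theorem rationalPointCount_planeSection_le {f : MvPolynomial (Fin (n + 1)) K} {ν : Fin (n + 1) → K}
    {ω η : Fin n → K} (h0 : planeSection f ν ω η ≠ 0) :
    rationalPointCount (planeSection f ν ω η) ≤ f.totalDegree * Fintype.card K := by
  calc rationalPointCount (planeSection f ν ω η)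
      ≤ (planeSection f ν ω η).totalDegree * Fintype.card K ^ (2 - 1) :=
        rationalPointCount_le_totalDegree_mul h0
    _ ≤ f.totalDegree * Fintype.card K := by
        rw [show (2 - 1 : ℕ) = 1 from rfl, pow_one]
        exact Nat.mul_le_mul_right _ (totalDegree_planeSection_le f ν ω η)

/-- Any section has at most `q²` zeros in `K²`. [folklore] -/
theorem rationalPointCount_planeSection_le_sq (f : MvPolynomial (Fin (n + 1)) K) (ν : Fin (n + 1) → K)
    (ω η : Fin n → K) : rationalPointCount (planeSection f ν ω η) ≤ Fintype.card K ^ 2 :=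
  rationalPointCount_le _

end Finite

end Literature.NumberTheory.DiophantineGeometry

end
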